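import Summits.KontsevichZagierPeriods.KontsevichZagierPeriods.Theorems.SoloInformedAlgCross
import HarnessLib

/-!
# The DEN-calculus over `K`: THEOREM 2D — every admissible denominator in two variables

Solo programme `solo-KontsevichZagierPeriods-informed`, session s107, step (x-u), the conclusion
of the general two-dimensional algorithm.

* `soloInformed_presentableDenK_dim2` — over a real-root-closed field `K ⊆ ℝ` of real algebraic
  numbers, **every** `Q ∈ K[x₀, x₁]` with no zero on the open square `(0,1)²` is a presentable
  denominator: after the grid `N = 2` and the reflection of each cell moving its inner corner to
  the origin, the zeros of the cell polynomial lie on the cross `{x₀ = 0} ∪ {x₁ = 0}`, and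
  THEOREM B applies.
* `soloInformed_realRootClosed_algebraicClosure` — the field of real algebraic numbers is
  real-root closed, so the theorem holds unconditionally over `algebraicClosure ℚ ℝ`
  (`soloInformed_presentableDenK_dim2_algebraicClosure`).
* `soloInformed_cubeResolution_dim2` — consequently the cube crux of the Kontsevich–Zagier
  programme is resolved for every integrand `P/Q` on `[0,1]²`, `P, Q` with real algebraic
  coefficients and `Q` non-vanishing on the open square: every such `IntegralRep` is, up to a
  positive integer multiple, a `ℤ`-combination of realised cube germs modulo the period relations.

References: M. Kontsevich, D. Zagier, *Periods* (2001), §1.2 and Problem 1; J. Kollár,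
*Lectures on Resolution of Singularities* (2007), §§1.8–1.10 (embedded resolution of plane
curves by blow-ups, here replaced by toric vertex charts, horizontal splits at algebraic
heights and maximal-contact induction).
-/

noncomputable section

open scoped BigOperators
open Literature.NumberTheory.Transcendental Literature.NumberTheory.Transcendental.KZ

namespace Summit.KontsevichZagierPeriods.KontsevichZagierPeriods.Theorems

variable {K : Type*} [Field K] [Algebra K ℝ]

/-! ### Step A: the grid `N = 2` puts all zeros of a cell on the cross -/

/-- After halving, a cell coordinate `(c + w)/2` with `c ∈ {0,1}`, `w ∈ [0,1]` that fails to lie in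
`(0,1)` forces `w = 0` if `c = 0` and `w = 1` if `c = 1`. [this work] -/
theorem soloInformed_halfCell_boundary {c : ℕ} (hc : c < 2) {w : ℝ} (hw0 : 0 ≤ w) (hw1 : w ≤ 1)
    (h : ¬ (0 < ((c : ℝ) + w) / 2 ∧ ((c : ℝ) + w) / 2 < 1)) :
    (c = 0 ∧ w = 0) ∨ (c = 1 ∧ w = 1) := by
  rcases Nat.lt_succ_iff.1 hc |>.eq_or_lt with h1 | h0
  · subst h1
    refine Or.inr ⟨rfl, le_antisymm hw1 ?_⟩
    by_contra hlt
    push Not at hlt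
    exact h ⟨by push_cast; linarith, by push_cast; linarith⟩
  · have h0' : c = 0 := by omega
    subst h0'
    refine Or.inl ⟨rfl, le_antisymm ?_ hw0⟩
    by_contra hlt
    push Not at hlt
    exact h ⟨by push_cast; linarith, by push_cast; linarith⟩

/-- **THEOREM 2D′.**  Over a real-root-closed field `K` of real algebraic numbers, every
polynomial in two variables with no zero on the open square is a presentable denominator.
[this work] -/
theorem soloInformed_presentableDenK_dim2
    (hK : ∀ c : K, IsAlgebraic ℚ (algebraMap K ℝ c)) (hKrc : SoloInformedRealRootClosed K)
    (Q : MvPolynomial (Fin 2) K)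
    (hQ : ∀ x ∈ soloInformedOpenCube 2, (MvPolynomial.aeval x Q : ℝ) ≠ 0) :
    SoloInformedPresentableDenK Q := by
  refine soloInformed_presentableDenK_of_grid hK (N := 2) two_pos hQ fun c hc => ?_
  set S : Finset (Fin 2) := Finset.univ.filter fun j => c j = 1 with hS
  have hQc : ∀ x ∈ soloInformedOpenCube 2,
      (MvPolynomial.aeval x (soloInformedGridSubstK Finset.univ 2 c Q) : ℝ) ≠ 0 := fun x hx => by
    rw [soloInformed_aeval_gridSubstK]
    exact hQ _ (soloInformed_gridMoveR_mem_openCube _ hc hx)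
  refine soloInformed_presentableDenK_of_vertexReflect hK S hQc
    (soloInformed_presentableDenK_of_crossZeros hK hKrc (fun x hx => ?_) fun y hy hy0 => ?_)
  · rw [soloInformed_aeval_vertexReflectK]
    exact hQc _ (soloInformed_vertexMove_mem S hx)
  · rw [soloInformed_aeval_vertexReflectK, soloInformed_aeval_gridSubstK,
      soloInformed_gridMoveR_univ] at hy0
    set w := soloInformedVertexMove S y with hw
    have hwc : w ∈ soloInformedCube 2 := soloInformed_vertexMove_mem_closedCube S hy
    -- the point `(c + w)/2` is a zero of `Q` in the closed square, hence not in the open square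
    have hnot : ¬ (fun j => ((c j : ℝ) + w j) / (2 : ℕ)) ∈ soloInformedOpenCube 2 :=
      fun hz => hQ _ hz hy0
    simp only [soloInformedOpenCube, Set.mem_setOf_eq, not_forall] at hnot
    obtain ⟨j, hj⟩ := hnot
    have hj' : ¬ (0 < ((c j : ℝ) + w j) / 2 ∧ ((c j : ℝ) + w j) / 2 < 1) := by exact_mod_cast hj
    have hyj : y j = 0 := by
      rcases soloInformed_halfCell_boundary (hc j) (hwc j).1 (hwc j).2 hj' with ⟨hc0, hw0⟩ | ⟨hc1, hw1⟩
      · have hjS : j ∉ S := by simp [hS, hc0]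
        have : w j = y j := by simp [hw, soloInformedVertexMove, hjS]
        rw [← this, hw0]
      · have hjS : j ∈ S := by simp [hS, hc1]
        have : w j = 1 - y j := by simp [hw, soloInformedVertexMove, hjS]
        linarith
    revert hyj
    fin_cases j
    · exact Or.inl
    · exact Or.inr

/-! ### The field of real algebraic numbers is real-root closed -/

/-- A real root of a non-zero polynomial with real algebraic coefficients is a real algebraic
number. [this work] -/
theorem soloInformed_realRootClosed_algebraicClosure :
    SoloInformedRealRootClosed (algebraicClosure ℚ ℝ) := by
  intro p hp z hz
  have halg : IsAlgebraic (algebraicClosure ℚ ℝ) z := ⟨p, hp, hz⟩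
  -- the two `ℚ`-algebra structures on the closure agree (`Subsingleton (Algebra ℚ _)`)
  haveI hA : Algebra.IsAlgebraic ℚ (algebraicClosure ℚ ℝ) := by
    convert algebraicClosure.isAlgebraic ℚ ℝ
    · rfl
    · exact Subsingleton.elim _ _
  have hint : IsIntegral ℚ z := isIntegral_trans z halg.isIntegral
  exact ⟨⟨z, mem_algebraicClosure_iff.2 hint.isAlgebraic⟩, rfl⟩

/-- **THEOREM 2D.**  Every polynomial in two variables with real algebraic coefficients and no
zero on the open square `(0,1)²` is a presentable denominator. [this work] -/
theorem soloInformed_presentableDenK_dim2_algebraicClosure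
    (Q : MvPolynomial (Fin 2) (algebraicClosure ℚ ℝ))
    (hQ : ∀ x ∈ soloInformedOpenCube 2, (MvPolynomial.aeval x Q : ℝ) ≠ 0) :
    SoloInformedPresentableDenK Q :=
  soloInformed_presentableDenK_dim2 soloInformed_algCoeff_algebraicClosure
    soloInformed_realRootClosed_algebraicClosure Q hQ

/-- **The cube crux in dimension two.**  For all `P, Q ∈ K[x₀, x₁]` with real algebraic
coefficients, `Q` without zero on the open square: every `IntegralRep` on `[0,1]²` whose
integrand is `P/Q` on the open square admits the resolution
`k • of r ∈ ℤ-span of realised cube germs + relations` with `k ≥ 1`. [this work] -/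
theorem soloInformed_cubeResolution_dim2 (P Q : MvPolynomial (Fin 2) (algebraicClosure ℚ ℝ))
    (hQ : ∀ x ∈ soloInformedOpenCube 2, (MvPolynomial.aeval x Q : ℝ) ≠ 0)
    (r : IntegralRep 2) (hr : r.domain = soloInformedCube 2)
    (hri : Set.EqOn r.integrand
      (fun x => (MvPolynomial.aeval x P : ℝ) / MvPolynomial.aeval x Q) (soloInformedOpenCube 2)) :
    ∃ (k : ℕ) (_ : k ≠ 0) (m' : ℕ) (d : Fin m' → ℕ) (G : ∀ j, SoloInformedCubeGerm (d j))
      (c : Fin m' → ℤ) (ρ : ∀ j, IntegralRep (d j)),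
      (∀ j, (ρ j).domain = soloInformedCube (d j)) ∧
      (∀ j, Set.EqOn (ρ j).integrand (fun x => ((G j).g (soloInformedToC (d j) x)).re)
        (soloInformedCube (d j))) ∧
      k • of r - ∑ j, c j • of (ρ j) ∈ relations :=
  soloInformed_cubeResolution_of_presentableDenK
    (soloInformed_presentableDenK_dim2_algebraicClosure Q hQ) P r hr hri

end Summit.KontsevichZagierPeriods.KontsevichZagierPeriods.Theorems
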